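import Summits.HodgeConjecture.HodgeConjecture.Theorems.CYFormCasimirCYFormSquarePrincipleInvariantForms
import Summits.HodgeConjecture.HodgeConjecture.Theorems.CYFormCasimirCYFormSquarePrincipleCup
import HarnessLib

/-!
# Crux X1 `CYFormCarrierEight` (route `CYFormCasimir`, stmt-HodgeConjecture-23493), helper file 9:
# every PAIRED monomial coordinate of `h_K⁴` is non-zero (Weil frame of a Hodge-general Weil eightfold)

research route conditional on HC_CM; not a corollary. Nothing here proves HC, HC_CM, the rung H2, X1 or `stub_cyform_exists`;
step S1 (second half, first input) of `Cruxes/CYFormCarrierEight/STUB-PLAN-stub_cyform_exists.md`: the non-vanishing of the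
diagonal `β(w_I, w^*_I)` of the duality pairing (helper file 8) reduces to the non-vanishing of the coordinates of `h_K⁴` at the
paired monomials `∏_{i ∈ S} wᵢ ∧ w^*ᵢ`, proved here without expanding `h_K⁴`:

* `h_K⁴ ≠ 0` has all non-paired, non-top coordinates zero (torus invariance, `repr_eq_zero_of_not_isPaired`) and both top
  coordinates zero (`repr_cupPowTwo_hK_top{Plus,Minus}Idx`), so SOME paired coordinate is non-zero (`exists_paired_repr_ne_zero`);
* the monomial elements `monoAuto σ c` of `SU_H(ℂ)` (any permutation `σ` of the `w`-indices, sign-corrected) fix `h_K⁴` and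
  permute the paired monomials transitively up to non-zero scalars, so EVERY paired coordinate is non-zero
  (`repr_cupPowTwo_hK_four_ne_zero_of_isPaired`).

References: vanGeemen1994HodgeAV (Lemma 6.10, proof of Thm. 6.12), FriedmanLaza2013 (§3.5 Lemma 36).
-/

-- `Summit.HodgeConjecture.HodgeConjecture.…` is the tree's mandated summit/problem namespace (single-problem summit).
set_option linter.dupNamespace false
noncomputable section

open CategoryTheory
open Literature.AlgebraicTopology.SingularHomology
open Literature.AlgebraicGeometry.Motives
open Literature.AlgebraicGeometry.HodgeTheory
open Literature.AlgebraicGeometry.VanGeemen1994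

namespace Summit.HodgeConjecture.HodgeConjecture.Theorems.CYFormCarrier

/-! ## §1 Generic: coordinates under a monomial action; block permutations; a permutation moving one set to another -/

section Generic

/-- **Transport of coordinates under a monomial action**: if `L (B i) = εᵢ • B (P i)` for a bijection `P` of the index
set, then the `P i`-th coordinate of `L z` is `εᵢ` times the `i`-th coordinate of `z` (the tree's private lemma of the
same name). [folklore] -/
theorem repr_apply_of_monomial' {ι M : Type*} [Fintype ι] [DecidableEq ι] [AddCommGroup M] [Module ℂ M]
    (B : Module.Basis ι ℂ M) (L : M →ₗ[ℂ] M) (P : Equiv.Perm ι) (ε : ι → ℂ)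
    (hL : ∀ i, L (B i) = ε i • B (P i)) (z : M) (i : ι) :
    B.repr (L z) (P i) = ε i * B.repr z i := by
  conv_lhs => rw [← B.sum_repr z, map_sum]
  simp_rw [map_smul, hL, smul_smul, map_sum, map_smul, B.repr_self, Finsupp.smul_single, smul_eq_mul, mul_one]
  rw [Finset.sum_apply', Finset.sum_eq_single i]
  · rw [Finsupp.single_eq_same, mul_comm]
  · intro j _ hj
    rw [Finsupp.single_eq_of_ne (fun h => hj (P.injective h).symm)]
  · intro h; exact absurd (Finset.mem_univ i) h

variable {k : ℕ}

/-- `blockPerm σ` on a first-block index (the tree's lemma is private). [folklore] -/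
theorem blockPerm_castAdd' (σ : Equiv.Perm (Fin k)) (i : Fin k) :
    blockPerm σ (Fin.castAdd k i) = Fin.castAdd k (σ i) := by
  rw [blockPerm, Equiv.permCongr_apply, finSumFinEquiv_symm_apply_castAdd, Equiv.sumCongr_apply, Sum.map_inl,
    finSumFinEquiv_apply_left]

/-- Membership in `permSet π s`: `j ∈ π(s) ↔ π⁻¹ j ∈ s`. [folklore] -/
theorem mem_permSet' {N : ℕ} (π : Equiv.Perm (Fin N)) {q : ℕ} (s : Set.powersetCard (Fin N) q) (j : Fin N) :
    j ∈ (permSet π s).val ↔ π.symm j ∈ s.val := by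
  change j ∈ s.val.map π.toEmbedding ↔ _
  rw [Finset.mem_map_equiv]

/-- `(blockPerm σ)⁻¹` on the two blocks. [folklore] -/
theorem blockPerm_symm_castAdd (σ : Equiv.Perm (Fin k)) (i : Fin k) :
    (blockPerm σ).symm (Fin.castAdd k i) = Fin.castAdd k (σ.symm i) := by
  rw [Equiv.symm_apply_eq, blockPerm_castAdd', Equiv.apply_symm_apply]

/-- `(blockPerm σ)⁻¹` on the second block. [folklore] -/
theorem blockPerm_symm_natAdd (σ : Equiv.Perm (Fin k)) (j : Fin k) :
    (blockPerm σ).symm (Fin.natAdd k j) = Fin.natAdd k (σ.symm j) := by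
  rw [Equiv.symm_apply_eq, CYFormSquare.blockPerm_natAdd', Equiv.apply_symm_apply]

/-- **A permutation of `Fin k` carrying a finite set onto another of the same cardinality.** [folklore] -/
theorem exists_perm_image_eq (S S' : Finset (Fin k)) (h : S.card = S'.card) :
    ∃ σ : Equiv.Perm (Fin k), ∀ i, σ.symm i ∈ S ↔ i ∈ S' := by
  classical
  have h1 : Fintype.card {x // x ∈ S} = Fintype.card {x // x ∈ S'} := by
    rw [Fintype.card_coe, Fintype.card_coe, h]
  have h2 : Fintype.card {x // ¬x ∈ S} = Fintype.card {x // ¬x ∈ S'} := by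
    rw [Fintype.card_subtype_compl, Fintype.card_subtype_compl, Fintype.card_coe, Fintype.card_coe, h]
  let e₁ : {x // x ∈ S} ≃ {x // x ∈ S'} := Fintype.equivOfCardEq h1
  let e₂ : {x // ¬x ∈ S} ≃ {x // ¬x ∈ S'} := Fintype.equivOfCardEq h2
  refine ⟨Equiv.subtypeCongr e₁ e₂, fun i ↦ ?_⟩
  set a := (Equiv.subtypeCongr e₁ e₂).symm i with ha
  have hi : (Equiv.subtypeCongr e₁ e₂) a = i := by rw [ha, Equiv.apply_symm_apply]
  constructor
  · intro haS
    have : (Equiv.subtypeCongr e₁ e₂) a = (e₁ ⟨a, haS⟩ : Fin k) := by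
      simp only [Equiv.subtypeCongr, Equiv.trans_apply, Equiv.sumCompl_symm_apply_of_pos haS, Equiv.sumCongr_apply,
        Sum.map_inl, Equiv.sumCompl_apply_inl]
    rw [← hi, this]; exact (e₁ ⟨a, haS⟩).2
  · intro hiS'
    by_contra haS
    have : (Equiv.subtypeCongr e₁ e₂) a = (e₂ ⟨a, haS⟩ : Fin k) := by
      simp only [Equiv.subtypeCongr, Equiv.trans_apply, Equiv.sumCompl_symm_apply_of_neg haS, Equiv.sumCongr_apply,
        Sum.map_inr, Equiv.sumCompl_apply_inr]
    have h' := (e₂ ⟨a, haS⟩).2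
    rw [← this, hi] at h'
    exact h' hiS'

/-- A paired index set of `Fin (k + k)` of cardinality `q` has first-block projection of cardinality with `2·# = q`. [folklore] -/
theorem two_mul_card_projW_of_isPaired {q : ℕ} (s : Set.powersetCard (Fin (k + k)) q) (hs : IsPaired s.val) :
    2 * (projW s.val).card = q := by
  classical
  have h := CYFormSquare.card_eq_card_projW_add s.val
  have h2 : (Finset.univ.filter fun j : Fin k ↦ Fin.natAdd k j ∈ s.val) = projW s.val := by
    ext j; rw [Finset.mem_filter, CYFormSquare.mem_projW_iff]; simp [(hs j)]
  rw [h2, s.prop] at h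
  omega

/-- **Block permutations act transitively on the paired index sets of a given cardinality.** [folklore] -/
theorem exists_perm_permSet_eq_of_isPaired {q : ℕ} (P₀ P : Set.powersetCard (Fin (k + k)) q)
    (h₀ : IsPaired P₀.val) (h : IsPaired P.val) :
    ∃ σ : Equiv.Perm (Fin k), permSet (blockPerm σ) P₀ = P := by
  have hc : (projW P₀.val).card = (projW P.val).card := by
    have a := two_mul_card_projW_of_isPaired P₀ h₀
    have b := two_mul_card_projW_of_isPaired P h
    omega
  obtain ⟨σ, hσ⟩ := exists_perm_image_eq (projW P₀.val) (projW P.val) hc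
  refine ⟨σ, Subtype.ext ?_⟩
  ext p
  refine Fin.addCases (fun i ↦ ?_) (fun j ↦ ?_) p
  · rw [mem_permSet', blockPerm_symm_castAdd, ← CYFormSquare.mem_projW_iff, hσ, CYFormSquare.mem_projW_iff]
  · rw [mem_permSet', blockPerm_symm_natAdd, ← h₀ (σ.symm j), ← CYFormSquare.mem_projW_iff, hσ,
      CYFormSquare.mem_projW_iff, h j]

end Generic

/-! ## §2 The paired coordinates of `h_K⁴` -/

section Paired

variable {A : AbelianVariety ℂ} {d : ℕ} {φ : A ⟶ A}
variable (hn : 2 ≤ 4) (hd : 0 < d) (hA : A.dim = 2 * 4) (hφ : φ ≫ φ = -(d • 𝟙 A))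
  (e : ProjectiveEmbedding A.X) {a : complexBetti (projectiveSpace e.n ℂ) 2} (ha : IsRationalClass a)
  (ha0 : a ≠ 0)

include hn hd hA hφ e ha ha0 in
/-- **Some paired coordinate of `h_K⁴` is non-zero**: `h_K⁴ ≠ 0`, and its coordinates at the non-paired non-top monomials
(torus invariance) and at the two tops vanish. [cite: vanGeemen1994HodgeAV, proof of Thm. 6.12] -/
theorem exists_paired_repr_ne_zero (hSU : HasHodgeGroupSU A φ 4 d (hK d φ e a)) :
    ∃ P : Set.powersetCard (Fin (2 * 4 + 2 * 4)) (2 * 4), IsPaired P.val ∧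
      (monB (bW hn hd hA hφ e ha ha0) (2 * 4)).repr (cupPowTwo (hK d φ e a) 4) P ≠ 0 := by
  classical
  by_contra hall
  push Not at hall
  set B := monB (bW hn hd hA hφ e ha ha0) (2 * 4) with hB
  have hmem : cupPowTwo (hK d φ e a) 4 ∈ hodgeClassSpan A.dim A.X 4 := cupPowTwo_hK_mem_hodgeClassSpan hn hd hA e ha ha0 4
  have hzero : ∀ s, B.repr (cupPowTwo (hK d φ e a) 4) s = 0 := by
    intro s
    by_cases hp : IsPaired s.val
    · exact hall s hp
    by_cases ht : IsTopPlus s.val ∨ IsTopMinus s.val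
    · rcases ht with ht | ht
      · rw [CYFormSquare.eq_topPlusIdx_of_isTopPlus' ht, hB, repr_cupPowTwo_hK_topPlusIdx hn hd hA hφ e ha ha0 hSU]
      · rw [CYFormSquare.eq_topMinusIdx_of_isTopMinus' ht, hB, repr_cupPowTwo_hK_topMinusIdx hn hd hA hφ e ha ha0 hSU]
    · obtain ⟨ht1, ht2⟩ := not_or.1 ht
      exact repr_eq_zero_of_not_isPaired (m := 2 * 4 - 1) (by omega) (by omega) hd hφ e ha ha0 (wBasis hd hφ hA) _
        (fun _ _ hne ↦ extAct_torusAuto_of_mem hn hd hA hφ e ha ha0 hSU hmem hne) s hp ht1 ht2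
  have h0 : cupPowTwo (hK d φ e a) 4 = 0 := by
    rw [← B.sum_repr (cupPowTwo (hK d φ e a) 4)]
    exact Finset.sum_eq_zero fun s _ ↦ by rw [hzero s, zero_smul]
  exact cupPowTwo_hK_ne_zero hn hd hA hφ e ha ha0 hSU (p := 4) (by norm_num) h0

/-- The unit `±1 ∈ ℂˣ` of the sign of a permutation. [folklore] -/
theorem exists_unit_sign {k : ℕ} (σ : Equiv.Perm (Fin k)) : ∃ u : ℂˣ, (u : ℂ) = (Equiv.Perm.sign σ : ℂ) ∧ (u : ℂ) * u = 1 := by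
  rcases Int.units_eq_one_or (Equiv.Perm.sign σ) with h | h
  · exact ⟨1, by rw [h]; simp, by simp⟩
  · exact ⟨-1, by rw [h]; simp, by simp⟩

include hn hd hA hφ e ha ha0 in
/-- **Every paired coordinate of `h_K⁴` is non-zero.** For paired `P₀`, `P` pick `σ` with `(σ ⊕ σ)(P₀) = P`; the monomial
element `u = monoAuto σ c` of `SU_H(ℂ)` (`c = sign σ` at one index of each block, `1` elsewhere) fixes the Hodge class `h_K⁴` and
maps `b_{P₀}` to a non-zero multiple of `b_P`, so the two coordinates differ by a non-zero factor.
[cite: vanGeemen1994HodgeAV, Lemma 6.10 and proof of Thm. 6.12] -/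
theorem repr_cupPowTwo_hK_four_ne_zero_of_isPaired (hSU : HasHodgeGroupSU A φ 4 d (hK d φ e a))
    (P : Set.powersetCard (Fin (2 * 4 + 2 * 4)) (2 * 4)) (hP : IsPaired P.val) :
    (monB (bW hn hd hA hφ e ha ha0) (2 * 4)).repr (cupPowTwo (hK d φ e a) 4) P ≠ 0 := by
  classical
  obtain ⟨P₀, hP₀, hne₀⟩ := exists_paired_repr_ne_zero hn hd hA hφ e ha ha0 hSU
  obtain ⟨σ, hσ⟩ := exists_perm_permSet_eq_of_isPaired P₀ P hP₀ hP
  obtain ⟨sg, hsg, hsg2⟩ := exists_unit_sign σ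
  -- the units: `sign σ` at index `0` of each block, `1` elsewhere
  let i₀ : Fin (2 * 4) := ⟨0, by omega⟩
  let c₀ : Fin (2 * 4) → ℂˣ := Function.update (fun _ ↦ 1) i₀ sg
  let c : Fin (2 * 4 + 2 * 4) → ℂˣ := Fin.append c₀ c₀
  have hcc : ∀ i, c (Fin.castAdd (2 * 4) i) = c₀ i := fun i ↦ by simp only [c, Fin.append_left]
  have hcn : ∀ i, c (Fin.natAdd (2 * 4) i) = c₀ i := fun i ↦ by simp only [c, Fin.append_right]
  have hprod : ∏ i, (c₀ i : ℂ) = sg := by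
    rw [Finset.prod_eq_single i₀]
    · simp only [c₀, Function.update_self]
    · intro b _ hb; simp only [c₀, Function.update_of_ne hb, Units.val_one]
    · intro h; exact absurd (Finset.mem_univ _) h
  set u := monoAuto (m := 2 * 4 - 1) (k := 2 * 4) (by omega) (by omega) hd hφ e ha ha0 (wBasis hd hφ hA) σ c with hu_def
  have hu : u ∈ weilSpecialUnitaryGroup A φ 4 d (hK d φ e a) := by
    refine monoAuto_mem_weilSpecialUnitaryGroup (m := 2 * 4 - 1) (by omega) (by omega) hd hφ e ha ha0 (wBasis hd hφ hA)
      4 d (by omega) rfl σ c (fun i ↦ ?_) ?_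
    · rw [hcc, hcn]
      by_cases hi : i = i₀
      · subst hi; simp only [c₀, Function.update_self]; exact hsg2
      · simp only [c₀, Function.update_of_ne hi, Units.val_one, mul_one]
    · simp_rw [hcc]; rw [hprod, ← hsg]; exact hsg2
  -- `⋀⁸u` fixes `h_K⁴` and acts on monomials by monomials
  have hfix : extAct (u : complexBetti A.X 1 →ₗ[ℂ] complexBetti A.X 1) (2 * 4) (cupPowTwo (hK d φ e a) 4) =
      cupPowTwo (hK d φ e a) 4 :=
    extAct_eq_self_of_mem_hodgeClassSpan hSU hu (cupPowTwo_hK_mem_hodgeClassSpan hn hd hA e ha ha0 4)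
  have hmono : ∀ s : Set.powersetCard (Fin (2 * 4 + 2 * 4)) (2 * 4), ∃ ε : ℂ, ε ≠ 0 ∧
      extAct (u : complexBetti A.X 1 →ₗ[ℂ] complexBetti A.X 1) (2 * 4) (monB (bW hn hd hA hφ e ha ha0) (2 * 4) s) =
        ε • monB (bW hn hd hA hφ e ha ha0) (2 * 4) (permSet (blockPerm σ) s) := fun s ↦
    extAct_monB_of_monomial _ _ (blockPerm σ) (fun p ↦ (c (blockPerm σ p) : ℂ)) (fun _ ↦ Units.ne_zero _)
      (fun p ↦ by rw [LinearEquiv.coe_coe, hu_def, monoAuto_weilBasis]) (2 * 4) s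
  choose ε hε0 hε using hmono
  set B := monB (bW hn hd hA hφ e ha ha0) (2 * 4) with hB
  have h := repr_apply_of_monomial' B _ (permSetEquiv (blockPerm σ) (2 * 4)) ε (fun s ↦ hε s)
    (cupPowTwo (hK d φ e a) 4) P₀
  rw [hfix] at h
  change B.repr (cupPowTwo (hK d φ e a) 4) (permSet (blockPerm σ) P₀) = _ at h
  rw [hσ] at h
  rw [h]
  exact mul_ne_zero (hε0 P₀) hne₀

end Paired

end Summit.HodgeConjecture.HodgeConjecture.Theorems.CYFormCarrier

end
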